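import Literature.AlgebraicGeometry.Motives.HodgeLieWeilSquareLift
import Literature.AlgebraicGeometry.Motives.HodgeLieWeilThreeThreeLine
import Literature.AlgebraicGeometry.Motives.HodgeLieEigenspaceNoInvariantForm
import Literature.Algebra.Lie.BilinearFormsStableSubspaceParity
import HarnessLib

/-!
# The Weil square has no twist of type II: `W⁻ ≇ (W⁺)^*` as modules over the traceless Hodge-degree-zero algebra — brick S3-II of the (3|3) WEIL square

Family `hodge`, layer `Literature/AlgebraicGeometry/Motives`, namespace `Literature.AlgebraicGeometry.Motives.HodgeStructure`, sub-namespace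
`WeilSquare`. THEOREMS ONLY (no definition, no named fact, no `sorry`). Written for the cell `pub-hodgeav-hg6` (req-37 (A) Q2b; eng-4 g7, brick
S3-II of `HOME/jobs/WEIL33-eng4g7/DESIGN.md` REV 4 §5). HONEST FRAMING: nothing here proves HC / HC_AV / HC_CM; unconditional linear algebra of
polarized weight-one Hodge structures; no step towards a summit statement.

SETTING (`Motives/HodgeLieWeilSquareGoursat`, `Motives/HodgeLieWeilSquareNoTwistOne`): `H` effective polarized of weight `1` on a `12`-dimensional
`V`, `End_Hdg(V) = ℚ + ℚφ`, `φ² = −d`, `μ² = −d`, `𝔷(𝔥) = 0`, `W^± = ker(φ_ℂ − μ) ∩ V^{1,0} / V^{0,1}` of dimension `3`, `𝔊⁰|_{W±} = End(W±)`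
(bricks S1). TWIST II = the third alternative of `WeilSquare.lift_or_twist`: a pairing `κ : W⁺ × W⁻ → ℂ`, non-degenerate on the left, with
`κ(Xp, w) + κ(p, Xw) = 0` for all `X ∈ 𝔊⁰` traceless on `W⁺`.

MAIN THEOREM **`WeilSquare.false_of_twistTwo`**: TWIST II is impossible. PROOF. (1) `κ` is invariant under ALL of `𝔊⁰` (`Θ` acts as `±1`) and
non-degenerate on both sides. (2) The forms `κ^M(p, p′) = κ(p, Mp′)`, `M ∈ 𝔥_ℂ` lowering, span a `𝔤𝔩(W⁺)`-stable subspace `S′ ⊆ Bil(W⁺)`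
(`κ^{[X,M]} = X⁺·κ^M`); `S′ ≠ Bil(W⁺)`: otherwise some lowering `M` has `M|_{W⁺} = ℓ ⊗ w₁` with `ℓ` killing the image of the thin-corner
raising element `B` (brick B1, `8 ∤ 12`) and `Bw₁ ≠ 0`, and `X = [B, M] ∈ 𝔊⁰` has `X|_{W⁻} = 0 ≠ X|_{W⁺}`, against the invariance of `κ`.
(3) By `Literature.Algebra.Lie.StableForms.symm_or_antisymm_of_ne_top` all `κ^M` have ONE parity `ε`; the identity
`κ(NMp, w) = κ(p, MNw)` transfers it to the raising forms `κ_N(w, w′) = κ(Nw, w′)` on the span of the `M(W⁺)`, which is `W⁻` (orbit lemma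
S0). (4) The form `b(x, y) = κ(π⁺x, π⁻y) − ε κ(π⁺y, π⁻x)` on `V_ℂ` is then non-degenerate on `W` and invariant under `𝔊⁰`, the raising and
the lowering elements, hence under `Lie Hg` — contradicting `CentralEigen.not_exists_invariant_form_on_eigenspace_of_endAlg_eq` (brick W5:
`End_{Lie Hg}(V) = End_Hdg(V) = K` forbids a `Lie Hg`-invariant pairing `W × W → ℂ`). In the `𝔰𝔬₆` / `𝔰𝔭₆` models of the square this
`b` is the defining form; W5 is where `End⁰ = K` exactly enters.

## References

* [Ribet1976RealMultiplications] K. A. Ribet, Amer. J. Math. 98 (1976), pp. 790–791.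
* [MoonenZarhin1999LowDim] B. Moonen, Yu. Zarhin, Math. Ann. 315 (1999), §2 (2.3), §3 proof of Lemma (3.4).
* [Deligne1982HodgeCycles] P. Deligne, LNM 900 (1982), I §3 (proof of Prop. 3.4), §4 (p. 30).
* [GoodmanWallachGTM255] R. Goodman, N. R. Wallach, *Symmetry, Representations, and Invariants* (2009), §5.5.2.
-/

noncomputable section

open scoped TensorProduct

namespace Literature.AlgebraicGeometry.Motives

namespace HodgeStructure

universe u

variable {V : Type u} [AddCommGroup V] [Module ℚ V] [Module.Finite ℚ V] [HodgeTensorFacts.{u, u}] {n : ℤ}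

set_option maxHeartbeats 6000000 in
/-- **The Weil square admits no twist of type II** (`V` of dimension `12`, `End_Hdg(V) = ℚ + ℚφ`, `𝔷(𝔥) = 0`, `dim W^± = 3`,
`𝔊⁰|_{W±} = End(W±)`): there is NO left-non-degenerate pairing `κ : W⁺ × W⁻ → ℂ` with `κ(Xp, w) + κ(p, Xw) = 0` for all `X ∈ 𝔊⁰` traceless
on `W⁺`. See the module docstring for the four steps (invariance under `𝔊⁰`; the `𝔤𝔩(W⁺)`-stable space of lowering forms is proper by the
thin-corner brick B1; one parity (`StableForms.symm_or_antisymm_of_ne_top`) transferred to the raising forms; the `Lie Hg`-invariant form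
`κ(π⁺x, π⁻y) − εκ(π⁺y, π⁻x)` on `W` contradicts brick W5). [cite: MoonenZarhin1999LowDim, §3 (proof of Lemma (3.4))]
[cite: Deligne1982HodgeCycles, I §3 (proof of Prop. 3.4)] [cite: Ribet1976RealMultiplications, pp. 790–791] [cite: GoodmanWallachGTM255, §5.5.2] -/
theorem WeilSquare.false_of_twistTwo [Nontrivial V] (H : HodgeStructure V n) (hn : n = 1) (heff : H.IsEffective) (ψ : H.Polarization)
    {φ : Module.End ℚ V} (hφE : φ ∈ H.endAlg) {d : ℚ} (hd : 0 < d) (hφ2 : φ * φ = -(d • 1))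
    (hE : ∀ a ∈ H.endAlg, ∃ x y : ℚ, a = x • 1 + y • φ) {μ : ℂ} (hμ : μ ^ 2 = -(d : ℂ))
    (hz : H.hodgeLie ⊓ Subalgebra.toSubmodule H.endAlg = ⊥)
    (hWp : Module.finrank ℂ ↥(Module.End.eigenspace (φ.baseChange ℂ) μ ⊓ H.piece 1 0) = 3)
    (hWm : Module.finrank ℂ ↥(Module.End.eigenspace (φ.baseChange ℂ) μ ⊓ H.piece 0 1) = 3) (hV : Module.finrank ℚ V = 12)
    (hSp : ∀ F : Module.End ℂ ↥(Module.End.eigenspace (φ.baseChange ℂ) μ ⊓ H.piece 1 0),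
      ∃ Y ∈ H.hodgeLieC, (∀ p ∈ H.piece 1 0, Y p ∈ H.piece 1 0) ∧ (∀ q ∈ H.piece 0 1, Y q ∈ H.piece 0 1) ∧
        ∀ p : ↥(Module.End.eigenspace (φ.baseChange ℂ) μ ⊓ H.piece 1 0), Y p = F p)
    (hSm : ∀ F : Module.End ℂ ↥(Module.End.eigenspace (φ.baseChange ℂ) μ ⊓ H.piece 0 1),
      ∃ Y ∈ H.hodgeLieC, (∀ p ∈ H.piece 1 0, Y p ∈ H.piece 1 0) ∧ (∀ q ∈ H.piece 0 1, Y q ∈ H.piece 0 1) ∧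
        ∀ w : ↥(Module.End.eigenspace (φ.baseChange ℂ) μ ⊓ H.piece 0 1), Y w = F w) :
    ¬ ∃ κ : ↥(Module.End.eigenspace (φ.baseChange ℂ) μ ⊓ H.piece 1 0) →ₗ[ℂ]
        ↥(Module.End.eigenspace (φ.baseChange ℂ) μ ⊓ H.piece 0 1) →ₗ[ℂ] ℂ,
      (∀ p, p ≠ 0 → ∃ w, κ p w ≠ 0) ∧
        ∀ X ∈ H.hodgeLieC, (∀ p ∈ H.piece 1 0, X p ∈ H.piece 1 0) → (∀ q ∈ H.piece 0 1, X q ∈ H.piece 0 1) →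
          ∀ (hXp : ∀ x ∈ Module.End.eigenspace (φ.baseChange ℂ) μ ⊓ H.piece 1 0, X x ∈ Module.End.eigenspace (φ.baseChange ℂ) μ ⊓ H.piece 1 0)
            (hXm : ∀ x ∈ Module.End.eigenspace (φ.baseChange ℂ) μ ⊓ H.piece 0 1, X x ∈ Module.End.eigenspace (φ.baseChange ℂ) μ ⊓ H.piece 0 1),
            LinearMap.trace ℂ _ (X.restrict hXp) = 0 → ∀ p w, κ (X.restrict hXp p) w + κ p (X.restrict hXm w) = 0 := by
  classical
  subst hn
  set W := Module.End.eigenspace (φ.baseChange ℂ) μ with hWdef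
  set Wp := W ⊓ H.piece 1 0 with hWpdef
  set Wm := W ⊓ H.piece 0 1 with hWmdef
  rintro ⟨κ, hκnd, hκ⟩
  obtain ⟨hμ0, hμc⟩ := UnitaryTheta.conj_eq_neg_of_sq hd hμ
  obtain ⟨-, hskew, hcomm, Θ, hΘ, hΘ𝔤⟩ := hodgeLie_standing H ψ
  obtain ⟨hPmem, hQmem, hΘ10, hΘ01, hΘΘ⟩ := UnitaryTheta.theta_facts H rfl heff hΘ
  have hΘ𝔥 : Θ ∈ H.hodgeLieC := H.mem_hodgeLieC_of_forall_piece hΘ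
  have hbrC : ∀ Y ∈ H.hodgeLieC, ∀ Z ∈ H.hodgeLieC, Y * Z - Z * Y ∈ H.hodgeLieC := fun Y hY Z hZ => H.commutator_mem_hodgeLieC hY hZ
  have hcφ : ∀ {X}, X ∈ H.hodgeLieC → X * φ.baseChange ℂ = φ.baseChange ℂ * X := fun {X} hX =>
    H.commute_baseChange_of_mem_hodgeLieC hX ⟨φ, hφE⟩
  have hXW : ∀ {X}, X ∈ H.hodgeLieC → ∀ w ∈ W, X w ∈ W := fun {X} hX w hw =>
    UnitaryTheta.apply_mem_eigenspace_of_commute (hcφ hX) hw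
  have hpres : ∀ {X}, X ∈ H.hodgeLieC → (∀ p ∈ H.piece 1 0, X p ∈ H.piece 1 0) → ∀ x ∈ Wp, X x ∈ Wp := fun {X} hX hXP x hx =>
    Submodule.mem_inf.2 ⟨hXW hX x (Submodule.mem_inf.1 hx).1, hXP x (Submodule.mem_inf.1 hx).2⟩
  have hpresm : ∀ {X}, X ∈ H.hodgeLieC → (∀ q ∈ H.piece 0 1, X q ∈ H.piece 0 1) → ∀ x ∈ Wm, X x ∈ Wm := fun {X} hX hXQ x hx =>
    Submodule.mem_inf.2 ⟨hXW hX x (Submodule.mem_inf.1 hx).1, hXQ x (Submodule.mem_inf.1 hx).2⟩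
  have hNWm : ∀ {N}, N ∈ H.hodgeLieC → (∀ v, N v ∈ H.piece 1 0) → ∀ x ∈ Wm, N x ∈ Wp := fun {N} hN hNim x hx =>
    Submodule.mem_inf.2 ⟨hXW hN x (Submodule.mem_inf.1 hx).1, hNim x⟩
  have hMWp : ∀ {M}, M ∈ H.hodgeLieC → (∀ v, M v ∈ H.piece 0 1) → ∀ x ∈ Wp, M x ∈ Wm := fun {M} hM hMim x hx =>
    Submodule.mem_inf.2 ⟨hXW hM x (Submodule.mem_inf.1 hx).1, hMim x⟩
  have hPQ : ∀ x ∈ H.piece 1 0, conj x ∈ H.piece 0 1 := fun x hx => conj_mem_piece H hx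
  have hQP : ∀ x ∈ H.piece 0 1, conj x ∈ H.piece 1 0 := fun x hx => conj_mem_piece H hx
  have hΘP : ∀ p ∈ H.piece 1 0, Θ p ∈ H.piece 1 0 := fun p hp => by rw [hΘ10 p hp]; exact hp
  have hΘQ : ∀ q ∈ H.piece 0 1, Θ q ∈ H.piece 0 1 := fun q hq => by rw [hΘ01 q hq]; exact Submodule.neg_mem _ hq
  have hΘres : Θ.restrict (hpres hΘ𝔥 hΘP) = (1 : Module.End ℂ ↥Wp) := LinearMap.ext fun p => Subtype.ext (by
    rw [LinearMap.coe_restrict_apply, Module.End.one_apply, hΘ10 _ (Submodule.mem_inf.1 p.2).2])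
  -- commutators of raising and lowering elements preserve the Hodge pieces
  have hcommP : ∀ {N M : Module.End ℂ (ℂ ⊗[ℚ] V)}, (∀ p ∈ H.piece 1 0, N p = 0) → (∀ v, N v ∈ H.piece 1 0) → (∀ q ∈ H.piece 0 1, M q = 0) →
      (∀ v, M v ∈ H.piece 0 1) → (∀ p ∈ H.piece 1 0, (N * M - M * N) p ∈ H.piece 1 0) ∧ (∀ q ∈ H.piece 0 1, (N * M - M * N) q ∈ H.piece 0 1) := by
    intro N M hNP hNim hMQ hMim
    refine ⟨fun p hp => ?_, fun q hq => ?_⟩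
    · rw [LinearMap.sub_apply, Module.End.mul_apply, Module.End.mul_apply, hNP p hp, map_zero, sub_zero]; exact hNim _
    · rw [LinearMap.sub_apply, Module.End.mul_apply, Module.End.mul_apply, hMQ q hq, map_zero, zero_sub]; exact Submodule.neg_mem _ (hMim _)
  -- (1) `κ` is invariant under all of `𝔊⁰`
  have hκ0 : ∀ {X} (hX : X ∈ H.hodgeLieC) (hXP : ∀ p ∈ H.piece 1 0, X p ∈ H.piece 1 0) (hXQ : ∀ q ∈ H.piece 0 1, X q ∈ H.piece 0 1)
      (p : ↥Wp) (w : ↥Wm), κ (X.restrict (hpres hX hXP) p) w + κ p (X.restrict (hpresm hX hXQ) w) = 0 := by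
    intro X hX hXP hXQ p w
    set c : ℂ := (3 : ℂ)⁻¹ * LinearMap.trace ℂ _ (X.restrict (hpres hX hXP)) with hcdef
    set D : Module.End ℂ (ℂ ⊗[ℚ] V) := X + (-c) • Θ with hDdef
    have hD𝔥 : D ∈ H.hodgeLieC := H.hodgeLieC.add_mem hX (H.hodgeLieC.smul_mem _ hΘ𝔥)
    have hDapply : ∀ v, D v = X v + (-c) • Θ v := fun v => by rw [hDdef, LinearMap.add_apply, LinearMap.smul_apply]
    have hDP : ∀ p ∈ H.piece 1 0, D p ∈ H.piece 1 0 := fun p hp => by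
      rw [hDapply]; exact Submodule.add_mem _ (hXP p hp) (Submodule.smul_mem _ _ (hΘP p hp))
    have hDQ : ∀ q ∈ H.piece 0 1, D q ∈ H.piece 0 1 := fun q hq => by
      rw [hDapply]; exact Submodule.add_mem _ (hXQ q hq) (Submodule.smul_mem _ _ (hΘQ q hq))
    have hDp : D.restrict (hpres hD𝔥 hDP) = X.restrict (hpres hX hXP) + (-c) • (1 : Module.End ℂ ↥Wp) := by
      rw [← hΘres]
      exact LinearMap.ext fun p => Subtype.ext (by
        simp only [LinearMap.coe_restrict_apply, LinearMap.add_apply, LinearMap.smul_apply, Submodule.coe_add, Submodule.coe_smul, hDapply])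
    have hDm : D.restrict (hpresm hD𝔥 hDQ) = X.restrict (hpresm hX hXQ) + c • (1 : Module.End ℂ ↥Wm) :=
      LinearMap.ext fun w => Subtype.ext (by
        simp only [LinearMap.coe_restrict_apply, LinearMap.add_apply, LinearMap.smul_apply, Submodule.coe_add, Submodule.coe_smul, hDapply,
          Module.End.one_apply, hΘ01 _ (Submodule.mem_inf.1 w.2).2, smul_neg, neg_smul, neg_neg])
    have htrD : LinearMap.trace ℂ _ (D.restrict (hpres hD𝔥 hDP)) = 0 := by
      rw [hDp, map_add, map_smul, LinearMap.trace_one, hWp, hcdef, smul_eq_mul]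
      push_cast
      ring
    have h := hκ D hD𝔥 hDP hDQ (hpres hD𝔥 hDP) (hpresm hD𝔥 hDQ) htrD p w
    rw [hDp, hDm] at h
    simp only [LinearMap.add_apply, LinearMap.smul_apply, Module.End.one_apply, map_add, map_smul, smul_eq_mul] at h
    linear_combination h
  -- (1') `κ` is non-degenerate on the right as well
  have hκnd' : ∀ w : ↥Wm, w ≠ 0 → ∃ p : ↥Wp, κ p w ≠ 0 := by
    intro w hw0
    have hinj : Function.Injective κ := by
      intro p p' hpp'
      by_contra hne
      obtain ⟨w', hw'⟩ := hκnd (p - p') (sub_ne_zero.2 hne)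
      exact hw' (by rw [map_sub, LinearMap.sub_apply, hpp', sub_self])
    have hsurj : Function.Surjective κ :=
      (LinearMap.injective_iff_surjective_of_finrank_eq_finrank (by rw [Subspace.dual_finrank_eq, hWp, hWm])).1 hinj
    obtain ⟨f, hf⟩ : ∃ f : Module.Dual ℂ ↥Wm, f w ≠ 0 := by
      by_contra h
      push Not at h
      exact hw0 ((Module.forall_dual_apply_eq_zero_iff ℂ w).1 h)
    obtain ⟨p, rfl⟩ := hsurj f
    exact ⟨p, hf⟩
  -- (2) the `𝔤𝔩(W⁺)`-stable space `S'` of lowering forms `κ^M(p, p') = κ(p, M p')`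
  let S' : Submodule ℂ (↥Wp →ₗ[ℂ] ↥Wp →ₗ[ℂ] ℂ) :=
    { carrier := {β | ∃ M ∈ H.hodgeLieC, (∀ q ∈ H.piece 0 1, M q = 0) ∧ (∀ v, M v ∈ H.piece 0 1) ∧
        ∃ Mr : ↥Wp →ₗ[ℂ] ↥Wm, (∀ p : ↥Wp, ((Mr p : ↥Wm) : ℂ ⊗[ℚ] V) = M p) ∧ β = κ.compl₂ Mr}
      add_mem' := by
        rintro β β' ⟨M, hM, hMQ, hMim, Mr, hMr, rfl⟩ ⟨M', hM', hM'Q, hM'im, Mr', hMr', rfl⟩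
        refine ⟨M + M', H.hodgeLieC.add_mem hM hM', fun q hq => ?_, fun v => ?_, Mr + Mr', fun p => ?_, ?_⟩
        · rw [LinearMap.add_apply, hMQ q hq, hM'Q q hq, add_zero]
        · rw [LinearMap.add_apply]; exact Submodule.add_mem _ (hMim v) (hM'im v)
        · rw [LinearMap.add_apply, Submodule.coe_add, hMr, hMr', LinearMap.add_apply]
        · exact LinearMap.ext fun p => LinearMap.ext fun p' => by
            simp only [LinearMap.add_apply, LinearMap.compl₂_apply, map_add]
      zero_mem' := ⟨0, H.hodgeLieC.zero_mem, fun q _ => rfl, fun v => Submodule.zero_mem _, 0, fun p => rfl,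
        LinearMap.ext fun p => LinearMap.ext fun p' => by simp only [LinearMap.zero_apply, LinearMap.compl₂_apply, map_zero]⟩
      smul_mem' := by
        rintro c β ⟨M, hM, hMQ, hMim, Mr, hMr, rfl⟩
        refine ⟨c • M, H.hodgeLieC.smul_mem c hM, fun q hq => ?_, fun v => ?_, c • Mr, fun p => ?_, ?_⟩
        · rw [LinearMap.smul_apply, hMQ q hq, smul_zero]
        · rw [LinearMap.smul_apply]; exact Submodule.smul_mem _ _ (hMim v)
        · rw [LinearMap.smul_apply, Submodule.coe_smul, hMr, LinearMap.smul_apply]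
        · exact LinearMap.ext fun p => LinearMap.ext fun p' => by
            simp only [LinearMap.smul_apply, LinearMap.compl₂_apply, map_smul, smul_eq_mul] }
  have hmemS' : ∀ β, β ∈ S' ↔ ∃ M ∈ H.hodgeLieC, (∀ q ∈ H.piece 0 1, M q = 0) ∧ (∀ v, M v ∈ H.piece 0 1) ∧
      ∃ Mr : ↥Wp →ₗ[ℂ] ↥Wm, (∀ p : ↥Wp, ((Mr p : ↥Wm) : ℂ ⊗[ℚ] V) = M p) ∧ β = κ.compl₂ Mr := fun β => Iff.rfl
  -- every lowering `M` gives a member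
  have hmkS' : ∀ {M} (hM : M ∈ H.hodgeLieC) (hMQ : ∀ q ∈ H.piece 0 1, M q = 0) (hMim : ∀ v, M v ∈ H.piece 0 1),
      κ.compl₂ (M.restrict (hMWp hM hMim)) ∈ S' := fun {M} hM hMQ hMim =>
    (hmemS' _).2 ⟨M, hM, hMQ, hMim, M.restrict (hMWp hM hMim), fun p => by rw [LinearMap.coe_restrict_apply], rfl⟩
  -- stability under `𝔤𝔩(W⁺)`
  have hS' : ∀ Z : Module.End ℂ ↥Wp, ∀ β ∈ S', β.compl₁₂ Z LinearMap.id + β.compl₂ Z ∈ S' := by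
    intro Z β hβ
    obtain ⟨M, hM, hMQ, hMim, Mr, hMr, rfl⟩ := (hmemS' β).1 hβ
    obtain ⟨X, hX, hXP, hXQ, hXZ⟩ := hSp Z
    have hres : X.restrict (hpres hX hXP) = Z := LinearMap.ext fun p => Subtype.ext (by rw [LinearMap.coe_restrict_apply]; exact hXZ p)
    refine (hmemS' _).2 ⟨M * X - X * M, hbrC M hM X hX, fun q hq => ?_, fun v => ?_,
      Mr ∘ₗ X.restrict (hpres hX hXP) - X.restrict (hpresm hX hXQ) ∘ₗ Mr, fun p => ?_, ?_⟩
    · rw [LinearMap.sub_apply, Module.End.mul_apply, Module.End.mul_apply, hMQ _ (hXQ q hq), hMQ q hq, map_zero, sub_zero]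
    · rw [LinearMap.sub_apply, Module.End.mul_apply, Module.End.mul_apply]
      exact Submodule.sub_mem _ (hMim _) (hXQ _ (hMim v))
    · rw [LinearMap.sub_apply, Submodule.coe_sub, LinearMap.comp_apply, LinearMap.comp_apply, hMr, LinearMap.coe_restrict_apply,
        LinearMap.coe_restrict_apply, hMr, LinearMap.sub_apply, Module.End.mul_apply, Module.End.mul_apply]
    · refine LinearMap.ext fun p => LinearMap.ext fun p' => ?_
      have h := hκ0 hX hXP hXQ p (Mr p')
      rw [hres] at h
      simp only [LinearMap.add_apply, LinearMap.compl₁₂_apply, LinearMap.compl₂_apply, LinearMap.id_apply, LinearMap.sub_apply,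
        LinearMap.comp_apply, map_sub, hres]
      linear_combination h
  -- (2') `S' ≠ Bil(W⁺)`: the thin corner
  obtain ⟨B, hB, hBP, hBim, hB0, w₀, hw₀, hw₀0, hBw₀⟩ :=
    WeilSquare.exists_raising_not_injective H rfl heff ψ hφE hd hφ2 hE hμ hz (m := 3) (by norm_num) hWp hWm (by rw [hV]; decide)
  obtain ⟨w₁, hw₁, hBw₁⟩ : ∃ w₁ ∈ Wm, B w₁ ≠ 0 := by
    by_contra hcon
    push Not at hcon
    exact hB0 (WeilSquare.raising_eq_zero_of_forall_minus H rfl heff ψ hφE hd hφ2 hμ hB hBP hBim hcon)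
  set Br : ↥Wm →ₗ[ℂ] ↥Wp := B.restrict (hNWm hB hBim) with hBrdef
  have hS'top : S' ≠ ⊤ := by
    intro htop
    -- a functional `ℓ ≠ 0` on `W⁺` killing the image of `B`
    have hrange : LinearMap.range Br < ⊤ := by
      refine lt_top_iff_ne_top.2 fun hsurj => ?_
      have hinj : Function.Injective Br :=
        (LinearMap.injective_iff_surjective_of_finrank_eq_finrank (by rw [hWm, hWp])).2 (LinearMap.range_eq_top.1 hsurj)
      have h0 : Br ⟨w₀, hw₀⟩ = 0 := Subtype.ext (by rw [hBrdef, LinearMap.coe_restrict_apply, Submodule.coe_zero]; exact hBw₀)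
      have h := hinj (h0.trans (map_zero Br).symm)
      exact hw₀0 (congrArg Subtype.val h)
    obtain ⟨ℓ, hℓ0, hℓ⟩ := Submodule.exists_dual_map_eq_bot_of_lt_top hrange inferInstance
    have hℓB : ∀ w : ↥Wm, ℓ (Br w) = 0 := fun w => by
      have h : ℓ (Br w) ∈ Submodule.map ℓ (LinearMap.range Br) := Submodule.mem_map_of_mem (LinearMap.mem_range_self Br w)
      rw [hℓ] at h
      exact (Submodule.mem_bot ℂ).1 h
    obtain ⟨p₁, hp₁⟩ : ∃ p₁ : ↥Wp, ℓ p₁ ≠ 0 := by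
      by_contra h
      push Not at h
      exact hℓ0 (LinearMap.ext h)
    -- the form `κ(p, ℓ(p') w₁)` is a member: a lowering `M` with `M|_{W⁺} = ℓ ⊗ w₁`
    have hmem : κ.compl₂ (ℓ.smulRight (⟨w₁, hw₁⟩ : ↥Wm)) ∈ S' := htop ▸ Submodule.mem_top
    obtain ⟨M, hM, hMQ, hMim, Mr, hMr, hMeq⟩ := (hmemS' _).1 hmem
    have hMrℓ : ∀ p' : ↥Wp, Mr p' = ℓ p' • (⟨w₁, hw₁⟩ : ↥Wm) := by
      intro p'
      by_contra hne
      obtain ⟨p, hp⟩ := hκnd' _ (sub_ne_zero.2 hne)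
      have h := congrArg (fun β : ↥Wp →ₗ[ℂ] ↥Wp →ₗ[ℂ] ℂ => β p p') hMeq
      simp only [LinearMap.compl₂_apply, LinearMap.smulRight_apply] at h
      exact hp (by rw [map_sub, h, sub_self])
    -- `X = [B, M]` preserves the pieces, vanishes on `W⁻`, and is non-zero on `W⁺`
    set X : Module.End ℂ (ℂ ⊗[ℚ] V) := B * M - M * B with hXdef
    have hX𝔥 : X ∈ H.hodgeLieC := hbrC B hB M hM
    obtain ⟨hXP, hXQ⟩ := hcommP hBP hBim hMQ hMim
    have hXapply : ∀ v, X v = B (M v) - M (B v) := fun v => by rw [hXdef, LinearMap.sub_apply, Module.End.mul_apply, Module.End.mul_apply]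
    have hXm0 : ∀ w : ↥Wm, X.restrict (hpresm hX𝔥 hXQ) w = 0 := fun w => Subtype.ext (by
      rw [LinearMap.coe_restrict_apply, Submodule.coe_zero, hXapply, hMQ _ (Submodule.mem_inf.1 w.2).2, map_zero, zero_sub, neg_eq_zero]
      have h1 : M (B w) = ((Mr (Br w) : ↥Wm) : ℂ ⊗[ℚ] V) := by rw [hMr, hBrdef, LinearMap.coe_restrict_apply]
      rw [h1, hMrℓ, hℓB, zero_smul, Submodule.coe_zero])
    have hXp1 : X.restrict (hpres hX𝔥 hXP) p₁ ≠ 0 := by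
      intro h0
      have h := congrArg Subtype.val h0
      rw [LinearMap.coe_restrict_apply, Submodule.coe_zero, hXapply, hBP _ (Submodule.mem_inf.1 p₁.2).2, map_zero, sub_zero] at h
      have h1 : M p₁ = ((Mr p₁ : ↥Wm) : ℂ ⊗[ℚ] V) := (hMr p₁).symm
      rw [h1, hMrℓ, Submodule.coe_smul, map_smul, smul_eq_zero] at h
      exact h.elim hp₁ hBw₁
    obtain ⟨w, hw⟩ := hκnd _ hXp1
    have h := hκ0 hX𝔥 hXP hXQ p₁ w
    rw [hXm0 w, map_zero, add_zero] at h
    exact hw h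
  -- (3) one parity for all lowering forms
  obtain ⟨ε, hεε, hparity⟩ : ∃ ε : ℂ, ε * ε = 1 ∧ ∀ β ∈ S', ∀ a c, β a c = ε * β c a := by
    rcases Literature.Algebra.Lie.StableForms.symm_or_antisymm_of_ne_top hS' hWp hS'top with h | h
    · exact ⟨1, one_mul 1, fun β hβ a c => by rw [one_mul]; exact h β hβ a c⟩
    · exact ⟨-1, by norm_num, fun β hβ a c => by rw [neg_one_mul]; exact h β hβ a c⟩
  have hε0 : ε ≠ 0 := fun h => by rw [h, mul_zero] at hεε; exact zero_ne_one hεε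
  -- parity of the lowering forms, pointwise
  have hparM : ∀ {M} (hM : M ∈ H.hodgeLieC) (hMQ : ∀ q ∈ H.piece 0 1, M q = 0) (hMim : ∀ v, M v ∈ H.piece 0 1) (a c : ↥Wp),
      κ a (M.restrict (hMWp hM hMim) c) = ε * κ c (M.restrict (hMWp hM hMim) a) := fun {M} hM hMQ hMim a c => by
    have h := hparity _ (hmkS' hM hMQ hMim) a c
    simp only [LinearMap.compl₂_apply] at h
    exact h
  -- the lowering `M₀ = B̄` is non-zero on `W⁺`
  obtain ⟨M₀, hM₀⟩ := exists_conjOp B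
  have hM₀𝔥 : M₀ ∈ H.hodgeLieC := by
    have hB' := hB
    rw [hodgeLieC_eq_spanC] at hB' ⊢
    exact conjOp_mem_spanC hB' hM₀
  have hM₀Q : ∀ q ∈ H.piece 0 1, M₀ q = 0 := fun q hq => by rw [hM₀, hBP _ (hQP q hq), map_zero]
  have hM₀im : ∀ v, M₀ v ∈ H.piece 0 1 := fun v => by rw [hM₀]; exact hPQ _ (hBim _)
  obtain ⟨p₀, hp₀, hM₀p₀⟩ : ∃ p₀ ∈ Wp, M₀ p₀ ≠ 0 := by
    have hB1 : ∃ x ∈ Module.End.eigenspace (φ.baseChange ℂ) (-μ) ⊓ H.piece 0 1, B x ≠ 0 := by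
      by_contra hcon
      push Not at hcon
      have hμ' : (-μ) ^ 2 = -(d : ℂ) := by rw [neg_sq]; exact hμ
      exact hB0 (WeilSquare.raising_eq_zero_of_forall_minus H rfl heff ψ hφE hd hφ2 hμ' hB hBP hBim hcon)
    obtain ⟨x, hx, hBx⟩ := hB1
    refine ⟨conj x, Submodule.mem_inf.2 ⟨(UnitaryTheta.conj_mem_eigenspace_iff' φ hμc x).2 (Submodule.mem_inf.1 hx).1,
      hQP _ (Submodule.mem_inf.1 hx).2⟩, fun h0 => hBx ?_⟩
    rw [hM₀, conj_conj] at h0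
    rw [← conj_conj (B x), h0, map_zero]
  -- (3') the span of the `M(W⁺)` is `W⁻` (orbit lemma S0)
  set Lgen : Set (ℂ ⊗[ℚ] V) := {x | ∃ M ∈ H.hodgeLieC, (∀ q ∈ H.piece 0 1, M q = 0) ∧ (∀ v, M v ∈ H.piece 0 1) ∧ ∃ p ∈ Wp, x = M p}
    with hLgen
  set L : Submodule ℂ (ℂ ⊗[ℚ] V) := Submodule.span ℂ Lgen with hLdef
  have hLWm : L ≤ Wm := by
    rw [hLdef]
    refine Submodule.span_le.2 ?_
    rintro _ ⟨M, hM, hMQ, hMim, p, hp, rfl⟩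
    exact hMWp hM hMim p hp
  have hLst : ∀ Y ∈ H.hodgeLieC, (∀ p ∈ H.piece 1 0, Y p ∈ H.piece 1 0) → (∀ q ∈ H.piece 0 1, Y q ∈ H.piece 0 1) →
      ∀ u ∈ L, Y u ∈ L := by
    intro Y hY hYP hYQ u hu
    rw [hLdef] at hu ⊢
    induction hu using Submodule.span_induction with
    | mem x hx =>
      obtain ⟨M, hM, hMQ, hMim, p, hp, rfl⟩ := hx
      -- `Y (M p) = [Y, M] p + M (Y p)`
      have h : Y (M p) = (Y * M - M * Y) p + M (Y p) := by
        rw [LinearMap.sub_apply, Module.End.mul_apply, Module.End.mul_apply, sub_add_cancel]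
      rw [h]
      refine Submodule.add_mem _ (Submodule.subset_span ⟨Y * M - M * Y, hbrC Y hY M hM, fun q hq => ?_, fun v => ?_, p, hp, rfl⟩)
        (Submodule.subset_span ⟨M, hM, hMQ, hMim, Y p, hpres hY hYP p hp, rfl⟩)
      · rw [LinearMap.sub_apply, Module.End.mul_apply, Module.End.mul_apply, hMQ q hq, map_zero, hMQ _ (hYQ q hq), sub_zero]
      · rw [LinearMap.sub_apply, Module.End.mul_apply, Module.End.mul_apply]
        exact Submodule.sub_mem _ (hYQ _ (hMim v)) (hMim _)
    | zero => rw [map_zero]; exact Submodule.zero_mem _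
    | add x y _ _ hx hy => rw [map_add]; exact Submodule.add_mem _ hx hy
    | smul a x _ hx => rw [map_smul]; exact Submodule.smul_mem _ a hx
  have hLeq : L = Wm := by
    rcases WeilSquare.eq_bot_or_eq_minus_of_stable H rfl heff ψ hφE hd hφ2 hE hμ L hLWm hLst with h | h
    · exfalso
      have hmem : M₀ p₀ ∈ L := hLdef ▸ Submodule.subset_span ⟨M₀, hM₀𝔥, hM₀Q, hM₀im, p₀, hp₀, rfl⟩
      rw [h, Submodule.mem_bot] at hmem
      exact hM₀p₀ hmem
    · exact h
  -- parity of the raising forms `κ(N w, w')`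
  have hparN : ∀ {N} (hN : N ∈ H.hodgeLieC) (hNP : ∀ p ∈ H.piece 1 0, N p = 0) (hNim : ∀ v, N v ∈ H.piece 1 0) (q w : ↥Wm),
      κ (N.restrict (hNWm hN hNim) q) w = ε * κ (N.restrict (hNWm hN hNim) w) q := by
    intro N hN hNP hNim q w
    -- on generators `q = M p`
    have hgen : ∀ x (hx : x ∈ L), ∀ hxm : x ∈ Wm,
        κ (N.restrict (hNWm hN hNim) ⟨x, hxm⟩) w = ε * κ (N.restrict (hNWm hN hNim) w) ⟨x, hxm⟩ := by
      intro x hx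
      rw [hLdef] at hx
      induction hx using Submodule.span_induction with
      | mem x hx =>
        intro hxm
        obtain ⟨M, hM, hMQ, hMim, p, hp, rfl⟩ := hx
        -- `κ(N M p, w) = κ(p, M N w)` from the invariance under `[N, M] ∈ 𝔊⁰`
        have hC𝔥 := hbrC N hN M hM
        obtain ⟨hCP, hCQ⟩ := hcommP hNP hNim hMQ hMim
        have h := hκ0 hC𝔥 hCP hCQ ⟨p, hp⟩ w
        have h1 : (N * M - M * N).restrict (hpres hC𝔥 hCP) ⟨p, hp⟩ = N.restrict (hNWm hN hNim) ⟨M p, hxm⟩ := Subtype.ext (by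
          rw [LinearMap.coe_restrict_apply, LinearMap.coe_restrict_apply, LinearMap.sub_apply, Module.End.mul_apply, Module.End.mul_apply,
            hNP p (Submodule.mem_inf.1 hp).2, map_zero, sub_zero])
        have h2 : (N * M - M * N).restrict (hpresm hC𝔥 hCQ) w = -(M.restrict (hMWp hM hMim) (N.restrict (hNWm hN hNim) w)) :=
          Subtype.ext (by
            rw [LinearMap.coe_restrict_apply, Submodule.coe_neg, LinearMap.coe_restrict_apply, LinearMap.coe_restrict_apply, LinearMap.sub_apply,
              Module.End.mul_apply, Module.End.mul_apply, hMQ _ (Submodule.mem_inf.1 w.2).2, map_zero, zero_sub])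
        rw [h1, h2, map_neg] at h
        -- `κ(p, M N w) = ε κ(N w, M p)` by the parity of `κ^M`
        have h3 := hparM hM hMQ hMim ⟨p, hp⟩ (N.restrict (hNWm hN hNim) w)
        have h4 : M.restrict (hMWp hM hMim) ⟨p, hp⟩ = ⟨M p, hxm⟩ := Subtype.ext (by rw [LinearMap.coe_restrict_apply])
        rw [h4] at h3
        linear_combination h + h3
      | zero =>
        intro hxm
        have h0 : (⟨0, hxm⟩ : ↥Wm) = 0 := Subtype.ext rfl
        rw [h0, map_zero, map_zero, LinearMap.zero_apply, map_zero, mul_zero]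
      | add x y hx' hy' hx hy =>
        intro hxm
        have hxL : x ∈ L := hLdef ▸ hx'
        have hyL : y ∈ L := hLdef ▸ hy'
        have hxy : (⟨x + y, hxm⟩ : ↥Wm) = ⟨x, hLWm hxL⟩ + ⟨y, hLWm hyL⟩ := Subtype.ext rfl
        rw [hxy, map_add, map_add, LinearMap.add_apply, map_add, hx (hLWm hxL), hy (hLWm hyL), mul_add]
      | smul a x hx' hx =>
        intro hxm
        have hxL : x ∈ L := hLdef ▸ hx'
        have hax : (⟨a • x, hxm⟩ : ↥Wm) = a • ⟨x, hLWm hxL⟩ := Subtype.ext rfl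
        rw [hax, map_smul, map_smul, LinearMap.smul_apply, map_smul, hx (hLWm hxL), smul_eq_mul, smul_eq_mul, mul_left_comm]
    have hq : (q : ℂ ⊗[ℚ] V) ∈ L := by rw [hLeq]; exact q.2
    have h := hgen q hq q.2
    exact h
  -- (4) the projections onto `W⁺`, `W⁻` and the invariant form
  set πP : Module.End ℂ (ℂ ⊗[ℚ] V) := (2 : ℂ)⁻¹ • (1 + Θ) with hπPdef
  set πQ : Module.End ℂ (ℂ ⊗[ℚ] V) := (2 : ℂ)⁻¹ • (1 - Θ) with hπQdef
  have hπP : ∀ v, πP v = (2 : ℂ)⁻¹ • (v + Θ v) := fun v => by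
    rw [hπPdef, LinearMap.smul_apply, LinearMap.add_apply, Module.End.one_apply]
  have hπQ : ∀ v, πQ v = (2 : ℂ)⁻¹ • (v - Θ v) := fun v => by
    rw [hπQdef, LinearMap.smul_apply, LinearMap.sub_apply, Module.End.one_apply]
  have hπPQ : ∀ v, πP v + πQ v = v := fun v => by
    rw [hπP, hπQ, ← smul_add, add_add_sub_cancel, ← two_smul ℂ v, smul_smul, inv_mul_cancel₀ (two_ne_zero' ℂ), one_smul]
  have hπPW : ∀ w ∈ W, πP w ∈ Wp := fun w hw => by
    rw [hπP]
    exact Submodule.mem_inf.2 ⟨Submodule.smul_mem _ _ (Submodule.add_mem _ hw (hXW hΘ𝔥 w hw)), hπP w ▸ hPmem w⟩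
  have hπQW : ∀ w ∈ W, πQ w ∈ Wm := fun w hw => by
    rw [hπQ]
    exact Submodule.mem_inf.2 ⟨Submodule.smul_mem _ _ (Submodule.sub_mem _ hw (hXW hΘ𝔥 w hw)), hπQ w ▸ hQmem w⟩
  have hπPp : ∀ p ∈ H.piece 1 0, πP p = p := fun p hp => by
    rw [hπP, hΘ10 p hp, ← two_smul ℂ p, smul_smul, inv_mul_cancel₀ (two_ne_zero' ℂ), one_smul]
  have hπQq : ∀ q ∈ H.piece 0 1, πQ q = q := fun q hq => by
    rw [hπQ, hΘ01 q hq, sub_neg_eq_add, ← two_smul ℂ q, smul_smul, inv_mul_cancel₀ (two_ne_zero' ℂ), one_smul]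
  have hπPq : ∀ q ∈ H.piece 0 1, πP q = 0 := fun q hq => by rw [hπP, hΘ01 q hq, add_neg_cancel, smul_zero]
  have hπQp : ∀ p ∈ H.piece 1 0, πQ p = 0 := fun p hp => by rw [hπQ, hΘ10 p hp, sub_self, smul_zero]
  set PW : Module.End ℂ (ℂ ⊗[ℚ] V) := (2 * μ)⁻¹ • (μ • (1 : Module.End ℂ (ℂ ⊗[ℚ] V)) + φ.baseChange ℂ) with hPWdef
  obtain ⟨hPWmem, hPWid, -⟩ := CentralEigen.projector_facts (V := V) hφ2 hμ hμ0
  set πp : (ℂ ⊗[ℚ] V) →ₗ[ℂ] ↥Wp := LinearMap.codRestrict Wp (πP * PW) (fun v => hπPW _ (hPWmem v)) with hπpdef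
  set πm : (ℂ ⊗[ℚ] V) →ₗ[ℂ] ↥Wm := LinearMap.codRestrict Wm (πQ * PW) (fun v => hπQW _ (hPWmem v)) with hπmdef
  have hπp : ∀ v, ((πp v : ↥Wp) : ℂ ⊗[ℚ] V) = πP (PW v) := fun v => by rw [hπpdef, LinearMap.codRestrict_apply, Module.End.mul_apply]
  have hπm : ∀ v, ((πm v : ↥Wm) : ℂ ⊗[ℚ] V) = πQ (PW v) := fun v => by rw [hπmdef, LinearMap.codRestrict_apply, Module.End.mul_apply]
  -- reading off the components of `p' + m'`
  have hπ_of : ∀ {p' m' : ℂ ⊗[ℚ] V} (hp' : p' ∈ Wp) (hm' : m' ∈ Wm), πp (p' + m') = ⟨p', hp'⟩ ∧ πm (p' + m') = ⟨m', hm'⟩ := by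
    intro p' m' hp' hm'
    have hW' : p' + m' ∈ W := Submodule.add_mem _ (Submodule.mem_inf.1 hp').1 (Submodule.mem_inf.1 hm').1
    refine ⟨Subtype.ext ?_, Subtype.ext ?_⟩
    · rw [hπp, hPWid _ hW', map_add, hπPp _ (Submodule.mem_inf.1 hp').2, hπPq _ (Submodule.mem_inf.1 hm').2, add_zero]
    · rw [hπm, hPWid _ hW', map_add, hπQp _ (Submodule.mem_inf.1 hp').2, hπQq _ (Submodule.mem_inf.1 hm').2, zero_add]
  have hsplit : ∀ w ∈ W, w = ((πp w : ↥Wp) : ℂ ⊗[ℚ] V) + ((πm w : ↥Wm) : ℂ ⊗[ℚ] V) := fun w hw => by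
    rw [hπp, hπm, hPWid w hw, hπPQ]
  have hπ_p : ∀ p' : ↥Wp, πp (p' : ℂ ⊗[ℚ] V) = p' ∧ πm (p' : ℂ ⊗[ℚ] V) = 0 := fun p' => by
    obtain ⟨h1, h2⟩ := hπ_of p'.2 (Submodule.zero_mem Wm)
    rw [add_zero] at h1 h2
    exact ⟨h1.trans (Subtype.coe_eta _ _), h2.trans (Subtype.ext rfl)⟩
  have hπ_m : ∀ m' : ↥Wm, πp (m' : ℂ ⊗[ℚ] V) = 0 ∧ πm (m' : ℂ ⊗[ℚ] V) = m' := fun m' => by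
    obtain ⟨h1, h2⟩ := hπ_of (Submodule.zero_mem Wp) m'.2
    rw [zero_add] at h1 h2
    exact ⟨h1.trans (Subtype.ext rfl), h2.trans (Subtype.coe_eta _ _)⟩
  set b : LinearMap.BilinForm ℂ (ℂ ⊗[ℚ] V) := κ.compl₁₂ πp πm + (-ε) • (κ.compl₁₂ πp πm).flip with hbdef
  have hb : ∀ x y, b x y = κ (πp x) (πm y) + (-ε) * κ (πp y) (πm x) := fun x y => by
    rw [hbdef, LinearMap.add_apply, LinearMap.add_apply, LinearMap.compl₁₂_apply, LinearMap.smul_apply, LinearMap.smul_apply,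
      LinearMap.flip_apply, LinearMap.compl₁₂_apply, smul_eq_mul]
  -- non-degeneracy on `W`
  have hbnd : ∀ w ∈ W, w ≠ 0 → ∃ w₂ ∈ W, b w w₂ ≠ 0 := by
    intro w hw hw0
    by_cases hp : πp w = 0
    · have hm : πm w ≠ 0 := fun hm => hw0 (by rw [hsplit w hw, hp, hm, Submodule.coe_zero, Submodule.coe_zero, add_zero])
      obtain ⟨p₂, hp₂⟩ := hκnd' _ hm
      refine ⟨p₂, (Submodule.mem_inf.1 p₂.2).1, ?_⟩
      rw [hb, hp, map_zero, LinearMap.zero_apply, zero_add, (hπ_p p₂).1]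
      exact mul_ne_zero (neg_ne_zero.2 hε0) hp₂
    · obtain ⟨m₂, hm₂⟩ := hκnd _ hp
      refine ⟨m₂, (Submodule.mem_inf.1 m₂.2).1, ?_⟩
      rw [hb, (hπ_m m₂).1, (hπ_m m₂).2, map_zero, LinearMap.zero_apply, mul_zero, add_zero]
      exact hm₂
  -- invariance under `Lie Hg`
  have hbinv : ∀ X ∈ H.hodgeLie, ∀ w ∈ W, ∀ w₂ ∈ W, b (X.baseChange ℂ w) w₂ + b w (X.baseChange ℂ w₂) = 0 := by
    intro X hX w hw w₂ hw₂
    have hY : X.baseChange ℂ ∈ H.hodgeLieC := H.baseChange_mem_hodgeLieC hX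
    obtain ⟨Zm, hZm, Z0, hZ0, Zp, hZp, hYeq, hZpP, hZpim, hZmQ, hZmim, -, -, hZ0P, hZ0Q⟩ :=
      SymplecticTheta.exists_decomp H.hodgeLieC hbrC hΘ𝔥 hΘΘ hΘ10 hΘ01 hPmem hQmem hY
    -- components of `w`, `w₂`
    set p := πp w with hpdef
    set m := πm w with hmdef
    set p₂ := πp w₂ with hp₂def
    set m₂ := πm w₂ with hm₂def
    have hw' := hsplit w hw
    have hw₂' := hsplit w₂ hw₂
    -- degree zero part
    have h0 : b (Z0 w) w₂ + b w (Z0 w₂) = 0 := by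
      have hZw : Z0 w = ((Z0.restrict (hpres hZ0 hZ0P) p : ↥Wp) : ℂ ⊗[ℚ] V) + ((Z0.restrict (hpresm hZ0 hZ0Q) m : ↥Wm) : ℂ ⊗[ℚ] V) := by
        rw [LinearMap.coe_restrict_apply, LinearMap.coe_restrict_apply, ← map_add, ← hw']
      have hZw₂ : Z0 w₂ = ((Z0.restrict (hpres hZ0 hZ0P) p₂ : ↥Wp) : ℂ ⊗[ℚ] V) + ((Z0.restrict (hpresm hZ0 hZ0Q) m₂ : ↥Wm) : ℂ ⊗[ℚ] V) := by
        rw [LinearMap.coe_restrict_apply, LinearMap.coe_restrict_apply, ← map_add, ← hw₂']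
      obtain ⟨e1, e2⟩ := hπ_of (Z0.restrict (hpres hZ0 hZ0P) p).2 (Z0.restrict (hpresm hZ0 hZ0Q) m).2
      obtain ⟨e3, e4⟩ := hπ_of (Z0.restrict (hpres hZ0 hZ0P) p₂).2 (Z0.restrict (hpresm hZ0 hZ0Q) m₂).2
      simp only [Subtype.coe_eta] at e1 e2 e3 e4
      rw [hb, hb, hZw, hZw₂, e1, e2, e3, e4]
      have i1 := hκ0 hZ0 hZ0P hZ0Q p m₂
      have i2 := hκ0 hZ0 hZ0P hZ0Q p₂ m
      linear_combination i1 + (-ε) * i2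
    -- raising part
    have hP' : b (Zp w) w₂ + b w (Zp w₂) = 0 := by
      have hZw : Zp w = ((Zp.restrict (hNWm hZp hZpim) m : ↥Wp) : ℂ ⊗[ℚ] V) := by
        rw [LinearMap.coe_restrict_apply]
        conv_lhs => rw [hw', map_add, hZpP _ (Submodule.mem_inf.1 p.2).2, zero_add]
      have hZw₂ : Zp w₂ = ((Zp.restrict (hNWm hZp hZpim) m₂ : ↥Wp) : ℂ ⊗[ℚ] V) := by
        rw [LinearMap.coe_restrict_apply]
        conv_lhs => rw [hw₂', map_add, hZpP _ (Submodule.mem_inf.1 p₂.2).2, zero_add]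
      rw [hb, hb, hZw, hZw₂, (hπ_p _).1, (hπ_p _).2, (hπ_p _).1, (hπ_p _).2, map_zero, map_zero, mul_zero, add_zero, zero_add,
        hparN hZp hZpP hZpim m₂ m]
      linear_combination (-(κ (Zp.restrict (hNWm hZp hZpim) m) m₂)) * hεε
    -- lowering part
    have hM' : b (Zm w) w₂ + b w (Zm w₂) = 0 := by
      have hZw : Zm w = ((Zm.restrict (hMWp hZm hZmim) p : ↥Wm) : ℂ ⊗[ℚ] V) := by
        rw [LinearMap.coe_restrict_apply]
        conv_lhs => rw [hw', map_add, hZmQ _ (Submodule.mem_inf.1 m.2).2, add_zero]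
      have hZw₂ : Zm w₂ = ((Zm.restrict (hMWp hZm hZmim) p₂ : ↥Wm) : ℂ ⊗[ℚ] V) := by
        rw [LinearMap.coe_restrict_apply]
        conv_lhs => rw [hw₂', map_add, hZmQ _ (Submodule.mem_inf.1 m₂.2).2, add_zero]
      rw [hb, hb, hZw, hZw₂, (hπ_m _).1, (hπ_m _).2, (hπ_m _).1, (hπ_m _).2, map_zero, LinearMap.zero_apply, LinearMap.zero_apply,
        zero_add, mul_zero, add_zero, hparM hZm hZmQ hZmim p₂ p]
      linear_combination (-(κ p (Zm.restrict (hMWp hZm hZmim) p₂))) * hεε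
    rw [hYeq]
    simp only [LinearMap.add_apply, map_add]
    linear_combination hM' + h0 + hP'
  -- (5) contradiction with the no-invariant-form brick
  have hWne : W ≠ ⊥ := by
    intro h
    have h1 : Wp = ⊥ := by rw [eq_bot_iff, ← h]; exact inf_le_left
    rw [h1, finrank_bot] at hWp
    exact three_ne_zero hWp.symm
  exact CentralEigen.not_exists_invariant_form_on_eigenspace_of_endAlg_eq H ψ hφE hd hφ2 hE hμ H.hodgeLie hΘ hΘ𝔤 hcomm hskew hWne
    ⟨b, hbnd, hbinv⟩

end HodgeStructure

end Literature.AlgebraicGeometry.Motives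

end
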